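import Mathlib
import HarnessLib

/-!
# Bergeron–Millson–Moeglin (2016), §3.7–3.8: the `θ`-stable parabolic subalgebras of `𝔲(p,q)` — the
# Young diagrams `(λ_+, λ_-)` of `𝔮(X)`, `R^± = |λ_±|`, and the worked case `U(2,1)`

Reproduction (typed, kernel-checked COMBINATORIAL part, in the style of
`Literature.RepresentationTheory.Semisimple.LimitOfDiscreteSeriesData` and
`Literature.RepresentationTheory.KashiwaraVergne1978.KVParam`) of: N. Bergeron, J. Millson, C. Moeglin,
*The Hodge conjecture and arithmetic quotients of complex balls*, Acta Math. **216** (2016) 1–125,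
§3.7–3.8 (= arXiv:1306.1515 §2.7–2.8; held text `paper:arxiv-1306.1515`, chunk p0012 L33–L63)
[BergeronMillsonMoeglin2016Balls], for `G = U(p,q)`, `K = U(p) × U(q)`, `V = V_+ ⊕ V_-`,
`𝔭 = 𝔭′ ⊕ 𝔭″ = (V_+ ⊗ V_-^*) ⊕ (V_- ⊗ V_+^*)` (§3.3–3.5; basis `x_{α,μ}` of `𝔭′`, `y_{α,μ}` of `𝔭″`,
`1 ≤ α ≤ p`, `p+1 ≤ μ ≤ p+q`).  Verbatim (chunk p0012): "Fix the Borel subalgebra of `𝔨` to be the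
algebra of matrices in `𝔨 = 𝔲(p) × 𝔲(q)` (block diagonal), which are upper-triangular on `V_+ = ℂ^p` and
lower-triangular on `V_- = ℂ^q` w.r.t. these bases. We may take `i𝔱₀` as the algebra of diagonal
matrices `(t_1, …, t_{p+q})`.  The roots of `𝔱` occuring in `𝔭′` are the linear forms `t_α − t_μ`. We
now classify all the `θ`-stable parabolic subalgebras `𝔮` of `𝔤`. Let `X = (t_1, …, t_{p+q})` be such
that its eigenvalues on the Borel subalgebra are non-negative. Therefore `t_1 ≥ … ≥ t_p` and
`t_{p+q} ≥ … ≥ t_{p+1}`.  In [TG] we associate two Young diagrams `λ_+` and `λ_-` to `X`: • The diagram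
`λ_+` is the sub-diagram of `p × q` which consists of the boxes of coordinates `(α, μ)` s.t.
`t_α > t_μ`. • The diagram `λ_-` is the sub-diagram of `p × q` which consists of the boxes of
coordinates `(α, μ)` s.t. `t_{p−α+1} < t_{q−μ+1}`. … Recall that we have associated to the parabolic
subalgebra `𝔮 = 𝔮(X)` the representations `V(𝔮)` and `A_𝔮`. The equivalent classes of both these
representations only depends on the pair `(λ_+, λ_-)`. We will therefore denote by `V(λ_+, λ_-)` and
`A(λ_+, λ_-)` these representations." and §3.8: "The `K`-representation `V(λ)` occurs with multiplicity
one in `∧^{|λ|}(V_+ ⊗ V_-^*)` where `|λ|` is the size of `λ`. The `K`-representation `V(λ_+, λ_-)` is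
the Cartan product of `V(λ_+)` and `V(λ_-)^*`. In our special situation — that of Vogan-Zuckerman
`K`-types — it occurs with multiplicity one in `∧^R 𝔭` where `R = |λ_+| + |λ_-|`."  ([TG] = N. Bergeron,
Transform. Groups 14 (2009) 41–86.)  Since `𝔲(X) ∩ 𝔭′` is spanned by the `x_{α,μ}` with `t_α > t_μ` and
`𝔲(X) ∩ 𝔭″` by the `y_{α,μ}` with `t_μ > t_α`, `|λ_+| = dim 𝔲 ∩ 𝔭⁺ = R⁺` and `|λ_-| = dim 𝔲 ∩ 𝔭⁻ = R⁻` in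
the notation of Vogan–Zuckerman, Prop 6.19 [VoganZuckerman1984] (`A_𝔮` has its lowest cohomology in
bidegree `(R⁺, R⁻)`; cf. `Literature.RepresentationTheory.VoganZuckerman1984.VoganZuckermanData`).

## What is here (real definitions + proved lemmas; nothing posited)

For `X` given by its two blocks `tp : Fin p → ℤ` (`t_1, …, t_p`) and `tq : Fin q → ℤ`
(`t_{p+1}, …, t_{p+q}`) — integer coordinates suffice, only the relative order matters:
* `IsDominant tp tq` — "`t_1 ≥ … ≥ t_p` and `t_{p+q} ≥ … ≥ t_{p+1}`";
* `lamPlus tp tq : Finset (Fin p × Fin q)` — the boxes `(α, μ)` with `t_α > t_μ` (= `λ_+`, 0-indexed);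
  `posBoxes tp tq` — the boxes with `t_α < t_μ` (the positions of `𝔲 ∩ 𝔭″`; `λ_-` is this set
  reflected through the centre of `p × q`, `lamMinus`); `Rplus = |λ_+|`, `Rminus = |λ_-|`, `R`;
* PROVED: `lamPlus` is a Young diagram (down-left closed) for dominant `X` (`lamPlus_lowerSet`), and so
  is `lamMinus` (`lamMinus_lowerSet`); `card_lamMinus : |λ_-| = #posBoxes`; `Rplus_add_Rminus_le :
  R⁺ + R⁻ ≤ pq`;
* the worked case `(p,q) = (2,1)` (`U(2,1)`, the group of the Picard modular surfaces): for every
  dominant `X`, `(R⁺, R⁻) ∈ {(0,0), (1,0), (0,1), (2,0), (1,1), (0,2)}` (`u21_pairs`), all six occur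
  (`u21_pairs_occur`), and `R = 1` iff `(R⁺, R⁻) = (1,0)` (pattern `t_2 = t_3 < t_1`, `λ_+` = one box,
  `λ_- = ∅`) or `(0,1)` (pattern `t_2 < t_3 = t_1`, `λ_+ = ∅`, `λ_-` = one box) (`u21_R_eq_one_iff`) — i.e.
  exactly two pairs `(λ_+, λ_-)` of total size one, of bidegrees `(1,0)` and `(0,1)`: the
  combinatorial content of "the cohomological representations of `U(2,1)` with `H¹ ≠ 0` are the two
  `A_𝔮` of Hodge types `(1,0)`, `(0,1)`" (compare `Literature.RepresentationTheory.BorelWallach2000.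
  SUn1Table.hdim_one_ne_zero_iff` for `SU(2,1)`).

NOT here: the parabolics `𝔮(X)` as Lie subalgebras, `V(λ)`, Schur functors, `A(λ_+, λ_-)`, the
description of the admissible pairs `(λ_+, λ_-)` ([TG]), the special parabolics `Q_{b,0}`, `Q_{0,a}`
(§3.11–3.12).

## References
* N. Bergeron, J. Millson, C. Moeglin, Acta Math. 216 (2016), §3.3–3.8 (= arXiv:1306.1515 §2.3–2.8,
  chunks p0010–p0012). [BergeronMillsonMoeglin2016Balls]
* D. A. Vogan Jr., G. J. Zuckerman, Compositio Math. 53 (1984), Prop 6.19 p. 84. [VoganZuckerman1984]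
-/

namespace Literature.RepresentationTheory.BergeronMillsonMoeglin2016

open Finset

variable {p q : ℕ}

/-- "`X = (t_1, …, t_{p+q})` … such that its eigenvalues on the Borel subalgebra are non-negative.
Therefore `t_1 ≥ … ≥ t_p` and `t_{p+q} ≥ … ≥ t_{p+1}`": the `V_+`-block is non-increasing, the
`V_-`-block non-decreasing (in the index). [cite: BergeronMillsonMoeglin2016Balls, §3.7] -/
def IsDominant (tp : Fin p → ℤ) (tq : Fin q → ℤ) : Prop := Antitone tp ∧ Monotone tq

/-- `λ_+`: "the boxes of coordinates `(α, μ)` s.t. `t_α > t_μ`" (0-indexed: `α : Fin p`, `μ : Fin q`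
standing for `p + 1 + μ`) — the roots `t_α − t_μ` of `𝔲(X) ∩ 𝔭′`.
[cite: BergeronMillsonMoeglin2016Balls, §3.7] -/
def lamPlus (tp : Fin p → ℤ) (tq : Fin q → ℤ) : Finset (Fin p × Fin q) :=
  univ.filter fun b => tq b.2 < tp b.1

/-- The positions `(α, μ)` with `t_α < t_μ` — the roots `t_μ − t_α` of `𝔲(X) ∩ 𝔭″` (before the
reflection that turns them into the Young diagram `λ_-`). [cite: BergeronMillsonMoeglin2016Balls, §3.7] -/
def posBoxes (tp : Fin p → ℤ) (tq : Fin q → ℤ) : Finset (Fin p × Fin q) :=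
  univ.filter fun b => tp b.1 < tq b.2

/-- `λ_-`: "the boxes of coordinates `(α, μ)` s.t. `t_{p−α+1} < t_{q−μ+1}`" — `posBoxes` reflected
through the centre of the `p × q` rectangle (0-indexed: `(α, μ) ∈ λ_-` iff `t_{rev α} < t_{rev μ}`).
[cite: BergeronMillsonMoeglin2016Balls, §3.7] -/
def lamMinus (tp : Fin p → ℤ) (tq : Fin q → ℤ) : Finset (Fin p × Fin q) :=
  univ.filter fun b => tp (Fin.rev b.1) < tq (Fin.rev b.2)

/-- `R⁺ = |λ_+| = dim 𝔲 ∩ 𝔭⁺`. [cite: BergeronMillsonMoeglin2016Balls, §3.8]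
[cite: VoganZuckerman1984, Prop 6.19 p. 84] -/
def Rplus (tp : Fin p → ℤ) (tq : Fin q → ℤ) : ℕ := (lamPlus tp tq).card

/-- `R⁻ = |λ_-| = dim 𝔲 ∩ 𝔭⁻` (defined on the unreflected positions; `card_lamMinus`).
[cite: BergeronMillsonMoeglin2016Balls, §3.8] [cite: VoganZuckerman1984, Prop 6.19 p. 84] -/
def Rminus (tp : Fin p → ℤ) (tq : Fin q → ℤ) : ℕ := (posBoxes tp tq).card

/-- `R = |λ_+| + |λ_-| = dim 𝔲 ∩ 𝔭`, the degree in which `V(λ_+, λ_-) ⊂ ∧^R 𝔭` and the first cohomology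
of `A(λ_+, λ_-)` sit. [cite: BergeronMillsonMoeglin2016Balls, §3.8, §3.2 (3.1)] -/
def R (tp : Fin p → ℤ) (tq : Fin q → ℤ) : ℕ := Rplus tp tq + Rminus tp tq

/-- Membership in `λ_+`. [cite: BergeronMillsonMoeglin2016Balls, §3.7] -/
@[simp] theorem mem_lamPlus (tp : Fin p → ℤ) (tq : Fin q → ℤ) (b : Fin p × Fin q) :
    b ∈ lamPlus tp tq ↔ tq b.2 < tp b.1 := by simp [lamPlus]

/-- Membership in the `𝔭″`-positions. [cite: BergeronMillsonMoeglin2016Balls, §3.7] -/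
@[simp] theorem mem_posBoxes (tp : Fin p → ℤ) (tq : Fin q → ℤ) (b : Fin p × Fin q) :
    b ∈ posBoxes tp tq ↔ tp b.1 < tq b.2 := by simp [posBoxes]

/-- Membership in `λ_-`. [cite: BergeronMillsonMoeglin2016Balls, §3.7] -/
@[simp] theorem mem_lamMinus (tp : Fin p → ℤ) (tq : Fin q → ℤ) (b : Fin p × Fin q) :
    b ∈ lamMinus tp tq ↔ tp (Fin.rev b.1) < tq (Fin.rev b.2) := by simp [lamMinus]

/-- `λ_-` is `posBoxes` reflected: `|λ_-| = #{(α, μ) : t_α < t_μ} = R⁻`.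
[cite: BergeronMillsonMoeglin2016Balls, §3.7–3.8] -/
theorem card_lamMinus (tp : Fin p → ℤ) (tq : Fin q → ℤ) :
    (lamMinus tp tq).card = Rminus tp tq := by
  unfold Rminus
  refine Finset.card_bij (fun b _ => (Fin.rev b.1, Fin.rev b.2)) ?_ ?_ ?_
  · intro b hb
    simpa using hb
  · intro b₁ _ b₂ _ h
    simp only [Prod.mk.injEq, Fin.rev_inj] at h
    exact Prod.ext h.1 h.2
  · intro b hb
    refine ⟨(Fin.rev b.1, Fin.rev b.2), ?_, by simp⟩
    simpa using hb

/-- `λ_+` and the `𝔭″`-positions are disjoint, so `R⁺ + R⁻ ≤ pq`.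
[cite: BergeronMillsonMoeglin2016Balls, §3.7–3.8] -/
theorem Rplus_add_Rminus_le (tp : Fin p → ℤ) (tq : Fin q → ℤ) : R tp tq ≤ p * q := by
  unfold R Rplus Rminus
  have hdisj : Disjoint (lamPlus tp tq) (posBoxes tp tq) := by
    rw [Finset.disjoint_left]
    intro b h1 h2
    rw [mem_lamPlus] at h1
    rw [mem_posBoxes] at h2
    omega
  rw [← Finset.card_union_of_disjoint hdisj]
  calc (lamPlus tp tq ∪ posBoxes tp tq).card ≤ (univ : Finset (Fin p × Fin q)).card :=
        Finset.card_le_card (Finset.subset_univ _)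
    _ = p * q := by simp

/-- For dominant `X`, `λ_+` is a Young diagram: closed under moving up and left
(`α' ≤ α`, `μ' ≤ μ`). [cite: BergeronMillsonMoeglin2016Balls, §3.7] -/
theorem lamPlus_lowerSet {tp : Fin p → ℤ} {tq : Fin q → ℤ} (h : IsDominant tp tq)
    {α α' : Fin p} {μ μ' : Fin q} (hα : α' ≤ α) (hμ : μ' ≤ μ) (hb : (α, μ) ∈ lamPlus tp tq) :
    (α', μ') ∈ lamPlus tp tq := by
  rw [mem_lamPlus] at hb ⊢
  have h1 : tp α ≤ tp α' := h.1 hα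
  have h2 : tq μ' ≤ tq μ := h.2 hμ
  simp only at hb ⊢
  omega

/-- For dominant `X`, `λ_-` is a Young diagram as well. [cite: BergeronMillsonMoeglin2016Balls, §3.7] -/
theorem lamMinus_lowerSet {tp : Fin p → ℤ} {tq : Fin q → ℤ} (h : IsDominant tp tq)
    {α α' : Fin p} {μ μ' : Fin q} (hα : α' ≤ α) (hμ : μ' ≤ μ) (hb : (α, μ) ∈ lamMinus tp tq) :
    (α', μ') ∈ lamMinus tp tq := by
  rw [mem_lamMinus] at hb ⊢
  have h1 : tp (Fin.rev α') ≤ tp (Fin.rev α) := h.1 (Fin.rev_le_rev.mpr hα)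
  have h2 : tq (Fin.rev μ) ≤ tq (Fin.rev μ') := h.2 (Fin.rev_le_rev.mpr hμ)
  simp only at hb ⊢
  omega

/-! ## The worked case `(p, q) = (2, 1)`: `U(2,1)` -/

section u21

/-- The two boxes of the `2 × 1` rectangle. [cite: BergeronMillsonMoeglin2016Balls, §3.7] -/
private theorem u21_univ :
    (univ : Finset (Fin 2 × Fin 1)) = {((0 : Fin 2), (0 : Fin 1)), (1, 0)} := by decide

/-- `R⁺` for `U(2,1)` in coordinates `X = (t₁, t₂ | s)`: `[t₁ > s] + [t₂ > s]`.
[cite: BergeronMillsonMoeglin2016Balls, §3.7] -/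
theorem u21_Rplus (tp : Fin 2 → ℤ) (tq : Fin 1 → ℤ) :
    Rplus tp tq = (if tq 0 < tp 0 then 1 else 0) + (if tq 0 < tp 1 then 1 else 0) := by
  unfold Rplus lamPlus
  rw [u21_univ, Finset.filter_insert, Finset.filter_singleton]
  by_cases c1 : tq 0 < tp 0 <;> by_cases c2 : tq 0 < tp 1 <;> simp [c1, c2]

/-- `R⁻` for `U(2,1)`: `[t₁ < s] + [t₂ < s]`. [cite: BergeronMillsonMoeglin2016Balls, §3.7] -/
theorem u21_Rminus (tp : Fin 2 → ℤ) (tq : Fin 1 → ℤ) :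
    Rminus tp tq = (if tp 0 < tq 0 then 1 else 0) + (if tp 1 < tq 0 then 1 else 0) := by
  unfold Rminus posBoxes
  rw [u21_univ, Finset.filter_insert, Finset.filter_singleton]
  by_cases c1 : tp 0 < tq 0 <;> by_cases c2 : tp 1 < tq 0 <;> simp [c1, c2]

/-- **The six bidegrees of `U(2,1)`**: for dominant `X = (t₁ ≥ t₂ | s)`,
`(R⁺, R⁻) ∈ {(0,0), (1,0), (0,1), (2,0), (1,1), (0,2)}` (so `(2,1)`, `(1,2)`, `(2,2)` do not occur:
the six `A(λ_+, λ_-)` are the trivial representation, the two with `R = 1`, and three with `R = 2`).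
[cite: BergeronMillsonMoeglin2016Balls, §3.7–3.8] -/
theorem u21_pairs {tp : Fin 2 → ℤ} {tq : Fin 1 → ℤ} (h : IsDominant tp tq) :
    (Rplus tp tq, Rminus tp tq) ∈
      ({(0,0), (1,0), (0,1), (2,0), (1,1), (0,2)} : Finset (ℕ × ℕ)) := by
  have h12 : tp 1 ≤ tp 0 := h.1 (by decide : (0 : Fin 2) ≤ 1)
  rw [u21_Rplus, u21_Rminus]
  simp only [Finset.mem_insert, Finset.mem_singleton, Prod.mk.injEq]
  split_ifs <;> omega

/-- All six pairs occur (explicit dominant witnesses).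
[cite: BergeronMillsonMoeglin2016Balls, §3.7] -/
theorem u21_pairs_occur :
    (Rplus ![0, 0] ![(0 : ℤ)], Rminus ![0, 0] ![(0 : ℤ)]) = (0, 0) ∧
    (Rplus ![1, 0] ![(0 : ℤ)], Rminus ![1, 0] ![(0 : ℤ)]) = (1, 0) ∧
    (Rplus ![1, 0] ![(1 : ℤ)], Rminus ![1, 0] ![(1 : ℤ)]) = (0, 1) ∧
    (Rplus ![1, 1] ![(0 : ℤ)], Rminus ![1, 1] ![(0 : ℤ)]) = (2, 0) ∧
    (Rplus ![2, 0] ![(1 : ℤ)], Rminus ![2, 0] ![(1 : ℤ)]) = (1, 1) ∧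
    (Rplus ![0, 0] ![(1 : ℤ)], Rminus ![0, 0] ![(1 : ℤ)]) = (0, 2) := by
  refine ⟨?_, ?_, ?_, ?_, ?_, ?_⟩ <;> decide

/-- **`R = 1` for `U(2,1)`**: for dominant `X`, `R⁺ + R⁻ = 1` iff either `t₂ = s < t₁`
(`(R⁺,R⁻) = (1,0)`, `λ_+` = the single box, `λ_- = ∅`) or `t₂ < s = t₁` (`(R⁺,R⁻) = (0,1)`, `λ_+ = ∅`,
`λ_-` = the single box): exactly two pairs `(λ_+, λ_-)` of total size one, of bidegrees `(1,0)` and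
`(0,1)`. [cite: BergeronMillsonMoeglin2016Balls, §3.7–3.8] [cite: VoganZuckerman1984, Prop 6.19 p. 84] -/
theorem u21_R_eq_one_iff {tp : Fin 2 → ℤ} {tq : Fin 1 → ℤ} (h : IsDominant tp tq) :
    R tp tq = 1 ↔
      (tp 1 = tq 0 ∧ tq 0 < tp 0 ∧ Rplus tp tq = 1 ∧ Rminus tp tq = 0 ∧
          lamPlus tp tq = {((0 : Fin 2), (0 : Fin 1))} ∧ lamMinus tp tq = ∅) ∨
      (tp 1 < tq 0 ∧ tq 0 = tp 0 ∧ Rplus tp tq = 0 ∧ Rminus tp tq = 1 ∧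
          lamPlus tp tq = ∅ ∧ lamMinus tp tq = {((0 : Fin 2), (0 : Fin 1))}) := by
  have h12 : tp 1 ≤ tp 0 := h.1 (by decide : (0 : Fin 2) ≤ 1)
  have eP := u21_Rplus tp tq
  have eM := u21_Rminus tp tq
  constructor
  · intro hR
    unfold R at hR
    by_cases c1 : tq 0 < tp 0 <;> by_cases c2 : tq 0 < tp 1 <;> by_cases c3 : tp 0 < tq 0 <;>
      by_cases c4 : tp 1 < tq 0 <;>
      simp only [c1, c2, c3, c4, if_true, if_false] at eP eM <;> (try omega)
    · -- t₂ = s < t₁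
      left
      refine ⟨by omega, c1, eP, eM, ?_, ?_⟩
      · ext ⟨a, m⟩
        fin_cases a <;> fin_cases m <;> simp [c1, c2]
      · ext ⟨a, m⟩
        fin_cases a <;> fin_cases m <;> simp [Fin.rev] <;> omega
    · -- t₂ < s = t₁
      right
      refine ⟨c4, by omega, eP, eM, ?_, ?_⟩
      · ext ⟨a, m⟩
        fin_cases a <;> fin_cases m <;> simp [c1, c2]
      · ext ⟨a, m⟩
        fin_cases a <;> fin_cases m <;> simp [Fin.rev] <;> omega
  · rintro (⟨-, -, hp, hm, -, -⟩ | ⟨-, -, hp, hm, -, -⟩) <;> simp [R, hp, hm]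

end u21

/-! ## The case `q = 1`: `U(p,1)` (compact arithmetic quotients of the complex `p`-ball)

For `q = 1` the Young diagrams are columns: `λ_+` has `a = #{α : t_α > s}` boxes and `λ_-` has
`b = #{α : t_α < s}` boxes, `a + b ≤ p`, and every pair `(a, b)` with `a + b ≤ p` occurs — matching
Borel–Wallach VI 4.8/4.11 for `SU(p,1)`: the `J_{a,b}` (`a + b ≤ p − 1`) and the discrete series `D_a`
(`a + b = p`) [BorelWallach2000]. -/

section up1

variable {p : ℕ}

/-- `|{α : Fin p | α < m}| = m` for `m ≤ p`. [folklore] -/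
private theorem card_filter_val_lt {m : ℕ} (hm : m ≤ p) :
    (univ.filter fun α : Fin p => (α : ℕ) < m).card = m := by
  rw [← Finset.card_map Fin.valEmbedding]
  have : (univ.filter fun α : Fin p => (α : ℕ) < m).map Fin.valEmbedding = Finset.range m := by
    ext j
    simp only [Finset.mem_map, Finset.mem_filter, Finset.mem_univ, true_and,
      Fin.valEmbedding_apply, Finset.mem_range]
    exact ⟨fun ⟨i, hi, hij⟩ => hij ▸ hi, fun hj => ⟨⟨j, lt_of_lt_of_le hj hm⟩, hj, rfl⟩⟩
  rw [this, Finset.card_range]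

/-- `|{α : Fin p | p - m ≤ α}| = m` for `m ≤ p`. [folklore] -/
private theorem card_filter_le_val {m : ℕ} (hm : m ≤ p) :
    (univ.filter fun α : Fin p => p - m ≤ (α : ℕ)).card = m := by
  rw [← Finset.card_map Fin.valEmbedding]
  have : (univ.filter fun α : Fin p => p - m ≤ (α : ℕ)).map Fin.valEmbedding =
      Finset.Ico (p - m) p := by
    ext j
    simp only [Finset.mem_map, Finset.mem_filter, Finset.mem_univ, true_and,
      Fin.valEmbedding_apply, Finset.mem_Ico]
    exact ⟨fun ⟨i, hi, hij⟩ => hij ▸ ⟨hi, i.isLt⟩, fun hj => ⟨⟨j, hj.2⟩, hj.1, rfl⟩⟩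
  rw [this, Nat.card_Ico]
  omega

/-- For `q = 1`: `R⁺ = #{α : t_α > s}` (the boxes `(α, 0)`). [cite: BergeronMillsonMoeglin2016Balls, §3.7] -/
theorem up1_Rplus (tp : Fin p → ℤ) (tq : Fin 1 → ℤ) :
    Rplus tp tq = (univ.filter fun α : Fin p => tq 0 < tp α).card := by
  unfold Rplus
  refine Finset.card_bij (fun b _ => b.1) ?_ ?_ ?_
  · intro b hb
    rw [mem_lamPlus] at hb
    simpa [Fin.fin_one_eq_zero b.2] using hb
  · intro b₁ h₁ b₂ h₂ h
    exact Prod.ext h ((Fin.fin_one_eq_zero _).trans (Fin.fin_one_eq_zero _).symm)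
  · intro α hα
    refine ⟨(α, 0), ?_, rfl⟩
    rw [mem_lamPlus]
    simpa using hα

/-- For `q = 1`: `R⁻ = #{α : t_α < s}`. [cite: BergeronMillsonMoeglin2016Balls, §3.7] -/
theorem up1_Rminus (tp : Fin p → ℤ) (tq : Fin 1 → ℤ) :
    Rminus tp tq = (univ.filter fun α : Fin p => tp α < tq 0).card := by
  unfold Rminus
  refine Finset.card_bij (fun b _ => b.1) ?_ ?_ ?_
  · intro b hb
    rw [mem_posBoxes] at hb
    simpa [Fin.fin_one_eq_zero b.2] using hb
  · intro b₁ h₁ b₂ h₂ h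
    exact Prod.ext h ((Fin.fin_one_eq_zero _).trans (Fin.fin_one_eq_zero _).symm)
  · intro α hα
    refine ⟨(α, 0), ?_, rfl⟩
    rw [mem_posBoxes]
    simpa using hα

/-- For `q = 1`: `R⁺ + R⁻ ≤ p`. [cite: BergeronMillsonMoeglin2016Balls, §3.7–3.8] -/
theorem up1_R_le (tp : Fin p → ℤ) (tq : Fin 1 → ℤ) : R tp tq ≤ p := by
  simpa using Rplus_add_Rminus_le tp tq

/-- **Every bidegree `(a, b)` with `a + b ≤ p` occurs for `U(p,1)`**: the dominant
`X = (1,…,1, 0,…,0, −1,…,−1 | 0)` with `a` ones and `b` minus-ones has `(R⁺, R⁻) = (a, b)` — so the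
`A(λ_+, λ_-)` of `U(p,1)` are indexed by the `(a, b)` with `a + b ≤ p` (for `SU(p,1)`: the `J_{a,b}`,
`a + b ≤ p − 1`, and the `D_a`, `a + b = p`, of Borel–Wallach VI 4.8).
[cite: BergeronMillsonMoeglin2016Balls, §3.7–3.8] [cite: BorelWallach2000, VI 4.8, Thm 4.11] -/
theorem up1_occur (a b : ℕ) (hab : a + b ≤ p) :
    ∃ tp : Fin p → ℤ, IsDominant tp ![(0 : ℤ)] ∧ Rplus tp ![(0 : ℤ)] = a ∧ Rminus tp ![(0 : ℤ)] = b := by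
  let tp : Fin p → ℤ := fun α => if (α : ℕ) < a then 1 else if (α : ℕ) < p - b then 0 else -1
  have htp : ∀ α : Fin p, tp α = if (α : ℕ) < a then 1 else if (α : ℕ) < p - b then 0 else -1 :=
    fun α => rfl
  refine ⟨tp, ⟨?_, ?_⟩, ?_, ?_⟩
  · intro α β hαβ
    have h' : (α : ℕ) ≤ (β : ℕ) := hαβ
    rw [htp, htp]
    split_ifs <;> omega
  · intro i j _
    simp [Fin.fin_one_eq_zero i, Fin.fin_one_eq_zero j]
  · rw [up1_Rplus]
    have : (univ.filter fun α : Fin p => (![(0 : ℤ)] : Fin 1 → ℤ) 0 < tp α) =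
        univ.filter fun α : Fin p => (α : ℕ) < a := by
      refine Finset.filter_congr fun α _ => ?_
      rw [htp]
      simp only [Matrix.cons_val_zero]
      split_ifs <;> omega
    rw [this, card_filter_val_lt (by omega)]
  · rw [up1_Rminus]
    have : (univ.filter fun α : Fin p => tp α < (![(0 : ℤ)] : Fin 1 → ℤ) 0) =
        univ.filter fun α : Fin p => p - b ≤ (α : ℕ) := by
      refine Finset.filter_congr fun α _ => ?_
      rw [htp]
      simp only [Matrix.cons_val_zero]
      have := α.isLt
      split_ifs <;> omega
    rw [this, card_filter_le_val (by omega)]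

end up1

end Literature.RepresentationTheory.BergeronMillsonMoeglin2016
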